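import Literature.NumberTheory.Automorphic.HeckeDoubleCosetOperators
import HarnessLib

/-!
# Words in the double-coset operators: the coset expansion of `T_{g_1} ⋯ T_{g_r} [K]`

Topic `NumberTheory/Automorphic`; namespace `Literature.NumberTheory.Automorphic.heckeAlgebra`;
theorems only, on top of `HeckeDoubleCosetOperators` (the double-coset operators
`doubleCosetOperator K g ∈ ℋ(G, K) = End_G(k[G ⧸ K])`, `toVector K T = T [K]`, central twists)
and `HeckeAlgebra` (coordinates `doubleCosetCoeffEquiv`).  Everything is proved, for an arbitrary
Hecke pair `(G, K)` (`[IsHeckeTriple ⊤ K K]`) and commutative coefficient ring `k`; nothing here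
refers to `GL_n`.  These are the bookkeeping rules behind the "triangularity" half of the
structure theorem of the spherical Hecke algebra of `GL_n` (Macdonald, *Symmetric functions and
Hall polynomials* (1995), Ch. II (2.3) with Ch. V (2.6); Shimura (1971), Prop. 3.15 and
Thm. 3.20), written for multisets of group elements so that no choice of representatives is
needed downstream.

* `exists_transversal`: every `KgK/K` has a finite transversal `s ⊆ G`;
  `doubleCosetIndicator_eq_sum_of_bijOn`, `doubleCosetOperator_apply_single_eq_sum`:
  `T_g [xK] = x · 𝟙_{KgK} = ∑_{y ∈ s} [x y K]`.
* **Product expansion** (`toVector_doubleCosetOperator_mul_of_eq_multisetSum`): if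
  `T [K] = ∑_{σ ∈ M} [σK]` for a multiset `M ⊆ G`, then
  `(T_g T) [K] = ∑_{σ ∈ M} ∑_{y ∈ s} [σ y K]`; iterating, a word `T_{g_r} ⋯ T_{g_1}` sends `[K]`
  to the sum of the cosets of all products `y_1 ⋯ y_r` of transversal elements (the coset form
  of the chain count of Macdonald (1995), Ch. II (2.3) / Ch. V (2.6) and Shimura (1971),
  Prop. 3.15).
* Coefficients and coordinates of such sums (`coeff_multisetSum_single`,
  `exists_mem_of_doubleCosetCoeff_ne_zero`: a double coset in the support of `T` is `KσK` for
  some `σ ∈ M`), the basis expansion `eq_sum_doubleCosetCoeff_smul`, and the span criterion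
  `mem_of_toVector_eq_multisetSum`.
* `isUnit_doubleCosetOperator_of_central`: `T_z` is a unit for `z` central
  (Macdonald (1995), Ch. V, (2.5): `c_{(1ⁿ)}` is a unit of `H(G, K)`).

## References

* I. G. Macdonald, *Symmetric functions and Hall polynomials*, 2nd ed. (1995), Ch. II (2.3),
  Ch. V §2 (2.5)–(2.6) [Macdonald1995].
* G. Shimura, *Introduction to the arithmetic theory of automorphic functions* (1971), §3.1,
  Prop. 3.15, Prop. 3.17 [ShimuraIATAF1971].
-/

open scoped Pointwise
open MonoidAlgebra Representation

namespace Literature.NumberTheory.Automorphic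

namespace heckeAlgebra

section Transversal

variable {G : Type*} [Group G] (K : Subgroup G)

/-- For a Hecke pair every double coset `KgK` has a finite transversal of its left cosets: a
finite set `s ⊆ G` mapped bijectively onto the `K`-orbit of `gK` in `G ⧸ K` (Shimura (1971),
Prop. 3.1). [folklore] -/
theorem exists_transversal [IsHeckeTriple (⊤ : Submonoid G) K K] (g : G) :
    ∃ s : Finset G, Set.BijOn (fun x : G => (x : G ⧸ K)) s (MulAction.orbit K (g : G ⧸ K)) := by
  classical
  obtain ⟨t, ht⟩ := (finite_orbit_quotient K g).exists_finset_coe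
  refine ⟨t.image Quotient.out, ?_, ?_, ?_⟩
  · intro x hx
    obtain ⟨y, hy, rfl⟩ := Finset.mem_image.1 hx
    change ((y.out : G) : G ⧸ K) ∈ MulAction.orbit K (g : G ⧸ K)
    rw [QuotientGroup.out_eq', ← ht]
    exact hy
  · intro x hx x' hx' h
    obtain ⟨y, -, rfl⟩ := Finset.mem_image.1 hx
    obtain ⟨y', -, rfl⟩ := Finset.mem_image.1 hx'
    simp only [QuotientGroup.out_eq'] at h
    rw [h]
  · intro y hy
    rw [← ht, Finset.mem_coe] at hy
    exact ⟨y.out, Finset.mem_coe.2 (Finset.mem_image_of_mem _ hy), QuotientGroup.out_eq' y⟩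

end Transversal

section Basic

variable {k G : Type*} [CommRing k] [Group G] (K : Subgroup G)

/-- The characteristic element `𝟙_{KgK}` is a finite sum over any transversal `s` of `KgK/K`:
`𝟙_{KgK} = ∑_{x ∈ s} [xK]`. [folklore] -/
theorem doubleCosetIndicator_eq_sum_of_bijOn (g : G) {s : Finset G}
    (hs : Set.BijOn (fun x : G => (x : G ⧸ K)) s (MulAction.orbit K (g : G ⧸ K))) :
    doubleCosetIndicator k G K g = ∑ x ∈ s, MonoidAlgebra.single (x : G ⧸ K) (1 : k) := by
  classical
  have himg : MulAction.orbit K (g : G ⧸ K) = ((s.image fun x : G => (x : G ⧸ K)) : Set (G ⧸ K)) := by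
    rw [Finset.coe_image, hs.image_eq]
  rw [doubleCosetIndicator, himg, finsum_mem_coe_finset,
    Finset.sum_image (fun x hx y hy h => hs.injOn hx hy h)]

/-- `x · 𝟙_{KgK} = ∑_{y ∈ s} [x y K]` for a transversal `s` of `KgK/K`. [folklore] -/
theorem ofMulAction_doubleCosetIndicator_eq_sum (g x : G) {s : Finset G}
    (hs : Set.BijOn (fun x : G => (x : G ⧸ K)) s (MulAction.orbit K (g : G ⧸ K))) :
    ofMulAction k G (G ⧸ K) x (doubleCosetIndicator k G K g) =
      ∑ y ∈ s, MonoidAlgebra.single ((x * y : G) : G ⧸ K) (1 : k) := by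
  rw [doubleCosetIndicator_eq_sum_of_bijOn K g hs, map_sum]
  refine Finset.sum_congr rfl fun y _ => ?_
  rw [ofMulAction_single]
  rfl

/-- For `K`-invariant `v`, `ρ(x̃) v = ρ(x) v` for the chosen representative `x̃` of `xK`.
[folklore] -/
theorem ofMulAction_out_coe {v : MonoidAlgebra k (G ⧸ K)}
    (hv : ∀ a ∈ K, ofMulAction k G (G ⧸ K) a v = v) (x : G) :
    ofMulAction k G (G ⧸ K) ((x : G ⧸ K).out) v = ofMulAction k G (G ⧸ K) x v := by
  obtain ⟨h, H⟩ := QuotientGroup.mk_out_eq_mul K x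
  rw [H, map_mul, Module.End.mul_apply, hv _ h.2]

/-- The coefficient of `[x]` in `∑_{σ ∈ M} [f σ]` is the number of `σ ∈ M` with `f σ = x`.
[folklore] -/
theorem coeff_multisetSum_single {ι : Type*} (M : Multiset ι) (f : ι → G ⧸ K) (x : G ⧸ K)
    [DecidablePred fun σ => f σ = x] :
    ((M.map fun σ => MonoidAlgebra.single (f σ) (1 : k)).sum).coeff x =
      (M.countP fun σ => f σ = x : ℕ) := by
  classical
  induction M using Multiset.induction_on with
  | empty => simp
  | cons a M ih =>
    rw [Multiset.map_cons, Multiset.sum_cons, MonoidAlgebra.coeff_add, Finsupp.add_apply, ih,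
      Multiset.countP_cons, MonoidAlgebra.coeff_single, Finsupp.single_apply]
    by_cases h : f a = x
    · rw [if_pos h, if_pos h]; push_cast; ring
    · rw [if_neg h, if_neg h]; push_cast; ring

/-- If `T [K] = ∑_{σ ∈ M} [σK]` and the coordinate of `T` at the double coset `D` is non-zero, then
`D = KσK` for some `σ ∈ M`. [folklore] -/
theorem exists_mem_of_doubleCosetCoeff_ne_zero {T : heckeAlgebra k G K} {M : Multiset G}
    (hT : toVector K T = (M.map fun σ : G => MonoidAlgebra.single (σ : G ⧸ K) (1 : k)).sum)
    {D : HeckeCoset (⊤ : Submonoid G) K K} (hD : doubleCosetCoeff K T D ≠ 0) :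
    ∃ σ ∈ M, HeckeCoset.mk K K ⟨σ, Submonoid.mem_top σ⟩ = D := by
  classical
  rw [doubleCosetCoeff_apply, ← toVector_apply, hT,
    coeff_multisetSum_single K M (fun σ : G => (σ : G ⧸ K))] at hD
  have hD' : 0 < M.countP fun σ : G => (σ : G ⧸ K) = ofHeckeCoset K D := by
    refine pos_iff_ne_zero.2 fun h => hD ?_
    rw [h, Nat.cast_zero]
  obtain ⟨σ, hσ, hσD⟩ := Multiset.countP_pos.1 hD'
  refine ⟨σ, hσ, ?_⟩
  rw [← toHeckeCoset_coe, hσD, toHeckeCoset_ofHeckeCoset]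

/-- `1 [K] = [K]` has the shape `∑_{σ ∈ M} [σK]` with `M = {1}`. [folklore] -/
theorem toVector_one_eq_multisetSum :
    toVector K (1 : heckeAlgebra k G K) =
      (({1} : Multiset G).map fun σ : G => MonoidAlgebra.single (σ : G ⧸ K) (1 : k)).sum := by
  simp [toVector_one]

end Basic

section DoubleCoset

variable {k G : Type*} [CommRing k] [Group G] (K : Subgroup G) [IsHeckeTriple (⊤ : Submonoid G) K K]

/-- `T_g [xK] = r · x · 𝟙_{KgK}` on a basis vector `r [xK]`. [folklore] -/
theorem doubleCosetOperator_apply_single (g x : G) (r : k) :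
    (doubleCosetOperator (k := k) K g : Module.End k (MonoidAlgebra k (G ⧸ K)))
        (MonoidAlgebra.single (x : G ⧸ K) r) =
      r • ofMulAction k G (G ⧸ K) x (doubleCosetIndicator k G K g) := by
  rw [doubleCosetOperator, coe_ofVector, extend_single,
    ofMulAction_out_coe K (fun _ ha => ofMulAction_doubleCosetIndicator K g ha)]

/-- **Action on coset vectors**: `T_g [xK] = ∑_{y ∈ s} [x y K]` for any transversal `s` of
`KgK/K` (Shimura (1971), §3.1; Macdonald (1995), Ch. V §2). [folklore] -/
theorem doubleCosetOperator_apply_single_eq_sum (g x : G) {s : Finset G}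
    (hs : Set.BijOn (fun x : G => (x : G ⧸ K)) s (MulAction.orbit K (g : G ⧸ K))) :
    (doubleCosetOperator (k := k) K g : Module.End k (MonoidAlgebra k (G ⧸ K)))
        (MonoidAlgebra.single (x : G ⧸ K) 1) =
      ∑ y ∈ s, MonoidAlgebra.single ((x * y : G) : G ⧸ K) (1 : k) := by
  rw [doubleCosetOperator_apply_single, one_smul, ofMulAction_doubleCosetIndicator_eq_sum K g x hs]

/-- `T_g [K] = ∑_{σ ∈ s} [σK]` (multiset form) for a transversal `s` of `KgK/K`. [folklore] -/
theorem toVector_doubleCosetOperator_eq_multisetSum (g : G) {s : Finset G}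
    (hs : Set.BijOn (fun x : G => (x : G ⧸ K)) s (MulAction.orbit K (g : G ⧸ K))) :
    toVector K (doubleCosetOperator (k := k) K g) =
      (s.val.map fun σ : G => MonoidAlgebra.single (σ : G ⧸ K) (1 : k)).sum := by
  rw [toVector_apply, doubleCosetOperator_apply_single_eq_sum K g 1 hs, Finset.sum_eq_multiset_sum]
  congr 1
  refine Multiset.map_congr rfl fun σ _ => ?_
  rw [one_mul]

/-- **Product expansion.** If `T [K] = ∑_{σ ∈ M} [σK]` for a multiset `M` of elements of `G`,
then `(T_g T) [K] = ∑_{σ ∈ M} ∑_{y ∈ s} [σ y K]` for any transversal `s` of `KgK/K`: the product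
of `End_G(k[G ⧸ K])` is composition and `T_g [σK] = σ · 𝟙_{KgK}`.  Iterating, a word
`T_{g_r} ⋯ T_{g_1}` sends `[K]` to the sum of the cosets `[y_1 ⋯ y_r K]` over all tuples of
transversal elements — the coset form of the chain count behind Macdonald (1995), Ch. II (2.3),
Ch. V (2.6) and Shimura (1971), Prop. 3.15. [cite: Macdonald1995, Ch. V (2.6)] -/
theorem toVector_doubleCosetOperator_mul_of_eq_multisetSum (g : G) {s : Finset G}
    (hs : Set.BijOn (fun x : G => (x : G ⧸ K)) s (MulAction.orbit K (g : G ⧸ K)))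
    {T : heckeAlgebra k G K} {M : Multiset G}
    (hT : toVector K T = (M.map fun σ : G => MonoidAlgebra.single (σ : G ⧸ K) (1 : k)).sum) :
    toVector K (doubleCosetOperator K g * T) =
      ((M.bind fun σ : G => s.val.map fun y => σ * y).map
        fun σ : G => MonoidAlgebra.single (σ : G ⧸ K) (1 : k)).sum := by
  rw [toVector_mul, hT, map_multiset_sum, Multiset.map_map, Multiset.map_bind, Multiset.sum_bind]
  congr 1
  refine Multiset.map_congr rfl fun σ _ => ?_
  rw [Function.comp_apply, doubleCosetOperator_apply_single_eq_sum K g σ hs, Multiset.map_map,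
    Finset.sum_eq_multiset_sum]
  rfl

/-- For `z` central, `T_z T_{z⁻¹} = 1`. [cite: Macdonald1995, Ch. V (2.5)] -/
theorem doubleCosetOperator_central_mul_inv {z : G} (hz : ∀ x : G, x * z = z * x) :
    doubleCosetOperator (k := k) K z * doubleCosetOperator K z⁻¹ = 1 := by
  rw [doubleCosetOperator_central_mul K hz, mul_inv_cancel, doubleCosetOperator_one]

/-- For `z` central, `T_{z⁻¹} T_z = 1`. [cite: Macdonald1995, Ch. V (2.5)] -/
theorem doubleCosetOperator_inv_mul_central {z : G} (hz : ∀ x : G, x * z = z * x) :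
    doubleCosetOperator (k := k) K z⁻¹ * doubleCosetOperator K z = 1 := by
  have hz' : ∀ x : G, x * z⁻¹ = z⁻¹ * x := fun x =>
    by rw [eq_inv_mul_iff_mul_eq, ← mul_assoc, ← hz x, mul_inv_cancel_right]
  rw [doubleCosetOperator_central_mul K hz', inv_mul_cancel, doubleCosetOperator_one]

/-- For `z` central, `T_z` is a **unit** of `ℋ(G, K)` with inverse `T_{z⁻¹}` (Macdonald (1995),
Ch. V, (2.5): `c_{(1ⁿ)}`, the characteristic function of `Kπ K = πK`, is a unit of `H(G, K)`;
Shimura (1971), Prop. 3.17). [cite: Macdonald1995, Ch. V (2.5)] -/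
theorem isUnit_doubleCosetOperator_of_central {z : G} (hz : ∀ x : G, x * z = z * x) :
    IsUnit (doubleCosetOperator (k := k) K z) :=
  ⟨⟨doubleCosetOperator K z, doubleCosetOperator K z⁻¹, doubleCosetOperator_central_mul_inv K hz,
    doubleCosetOperator_inv_mul_central K hz⟩, rfl⟩

/-- Expansion of `T ∈ ℋ(G, K)` in the double-coset basis: `T = ∑_D T_D · e⁻¹(δ_D)` over the
support of its coordinates `e = doubleCosetCoeffEquiv`. [folklore] -/
theorem eq_sum_doubleCosetCoeff_smul (T : heckeAlgebra k G K) :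
    T = ∑ D ∈ (doubleCosetCoeff K T).support,
      doubleCosetCoeff K T D • (doubleCosetCoeffEquiv K).symm (Finsupp.single D 1) := by
  conv_lhs => rw [← (doubleCosetCoeffEquiv K).symm_apply_apply T, doubleCosetCoeffEquiv_apply,
    ← Finsupp.sum_single (doubleCosetCoeff K T), Finsupp.sum, map_sum]
  refine Finset.sum_congr rfl fun D _ => ?_
  rw [← Finsupp.smul_single_one, map_smul]

/-- **Span criterion**: if `T [K] = ∑_{σ ∈ M} [σK]` and a submodule `N` of `ℋ(G, K)` contains
`T_σ` for every `σ ∈ M`, then `T ∈ N` (the support of the coordinates of `T` consists of the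
double cosets `KσK`, `σ ∈ M`). [folklore] -/
theorem mem_of_toVector_eq_multisetSum {T : heckeAlgebra k G K} {M : Multiset G}
    (hT : toVector K T = (M.map fun σ : G => MonoidAlgebra.single (σ : G ⧸ K) (1 : k)).sum)
    {N : Submodule k (heckeAlgebra k G K)} (hN : ∀ σ ∈ M, doubleCosetOperator K σ ∈ N) :
    T ∈ N := by
  rw [eq_sum_doubleCosetCoeff_smul K T]
  refine Submodule.sum_mem _ fun D hD => Submodule.smul_mem _ _ ?_
  obtain ⟨σ, hσ, rfl⟩ := exists_mem_of_doubleCosetCoeff_ne_zero K hT (Finsupp.mem_support_iff.1 hD)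
  rw [← doubleCosetOperator_eq_doubleCosetCoeffEquiv_symm]
  exact hN σ hσ

end DoubleCoset

end heckeAlgebra

end Literature.NumberTheory.Automorphic
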